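import Mathlib
import HarnessLib
import HarnessLib.Audit
import Summits.AtomisticToContinuum.Statement
import Literature.MathematicalPhysics.StatisticalMechanics.Theil2006
import Literature.MathematicalPhysics.StatisticalMechanics.CrystallizationLocalLimit
import Literature.MathematicalPhysics.StatisticalMechanics.LennardJonesClusters
import Literature.MathematicalPhysics.StatisticalMechanics.CrystallizationSymmetries
import Literature.MathematicalPhysics.StatisticalMechanics.LennardJonesThermodynamicLimitProofs
import Literature.MathematicalPhysics.StatisticalMechanics.PeriodicConfigurationSums

/-!
Route: PlaneFirstTrueLJ

CLOSED (retired) 2026-08-15T13:45:38Z by operator:999:1257524 — reason: not-a-thesis: assembly does not conclude the sub-problem Statement — note: D-0027 §2.1 audit (human 2026-08-15: routes that do not decide the summit are removed): the assembly concludes `PlanarCrystallization`, not the sub-problem statement; a NEW conforming route may be opened from the same idea (generated `closes : … → _root_.Crystallization`).. The file is kept as the record of this route; refuted decls are indexed as negative knowledge (`ledger negatives`).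

# Route PlaneFirstTrueLJ — the plane first — Blanc–Lewin crystallization for TRUE (12,6)
Lennard-Jones in d=2 via sharp defect-counting energy bounds, the one-centre certificate as layer-2
engine

RUNG ROUTE (idea card AtomisticToContinuum/Crystallization/plane-first-true-lj-12-6). Target X =
PlanarCrystallization := the Blanc–Lewin
statement of the tree for the TRUE Lennard-Jones potential V = r⁻¹²/12 − r⁻⁶/6 in dimension d = 2:
`HasPeriodicGroundStateEnergy lennardJones 2
∧ IsCrystallizing lennardJones 2` (both predicates are dimension-generic in
Literature/…/Crystallization.lean). X is NOT the d = 3 conjunct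
`Summit.AtomisticToContinuum.Crystallization` and neither implies the other; X is the open planar
problem (BlancLewin2015 §2.3, LucaFriesecke2016
§1, BeterminPetrache2019 Q1.2–1.3: every proved 2-D theorem needs a narrow well and a tiny tail, and
the in-tree barrier
LocalizedPotentialsExcludeLennardJones proves (12,6) lies outside Theil's and Flatley–Theil's
classes). Value for the summit: the first
Blanc–Lewin theorem for the actual (12,6) potential in any d ≥ 2, and a debugged Lean assembly
(energy bound → zero defect density →
exact local limit → lattice) that the d = 3 cards (steepness-ladder-one-centre,
hull-exactification-cascade) reuse verbatim.
It suffices to show (two layers; cruxes first, glue later), with a = the optimal triangular scale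
(the minimiser of Theil's dilated lattice sum
f(a) = Σ_{ξ∈A₂∖0} V(a|ξ|); 2e* := f(a*) = −0.563687, a* = (S₁₂/S₆)^{1/6} = 0.99019) and "i is
η-hexagonal" := some rigid motion g with g(0) = x_i
puts a particle within ηa of each of the six points g(a·u), |u| = 1, u ∈ A₂, and every particle
within 3a/2 of x_i within ηa of g(a·{0,u}):
(rank 2) DefectCoresCostEnergy2D — for (1/2)-separated finite configurations, 2E(x) − N f(a*) ≥
c₀·#{non-(1/8)-hexagonal particles};
(rank 3) StrainCostsEnergy2D — ∀η ∃c(η): 2E(x) − N f(a*) + C·#{non-(1/8)-hexagonal} ≥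
c(η)·#{non-η-hexagonal};
(rank 4) SharpEnergyBound2D — 2E(x) ≥ N f(a*) (the c = 0 shadow of rank 2, = the energetic planar
conjecture by Fekete; filed as the
independently closable milestone); supports: SeparationHalf2D (ground states are 1/2-separated),
TrialUpperBound2D (limsup E(N)/N ≤ e(Q) for
every periodic Q), OptimalScale2D, TriangularConfiguration2D (a·A₂ as a PeriodicConfiguration with e
= f(a)/2), HexagonRigidity2D (exact local
hexagons ⇒ rigid image of a·A₂), Exactification2D (zero defect density ⇒ IsCrystallizing
lennardJones 2).
Lean: `Literature.MathematicalPhysics.StatisticalMechanics.HasPeriodicGroundStateEnergy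
Literature.MathematicalPhysics.StatisticalMechanics.lennardJones 2 ∧
Literature.MathematicalPhysics.StatisticalMechanics.IsCrystallizing
Literature.MathematicalPhysics.StatisticalMechanics.lennardJones 2`

## Assembly
Bookkeeping over proved cone facts. Energetic half: a from OptimalScale2D, P_a from
TriangularConfiguration2D (e(P_a) = f(a)/2); ground states
exist (exists_isGroundState_lennardJones, d = 2) and are 1/2-separated (SeparationHalf2D), so
SharpEnergyBound2D gives E(N) ≥ N f(a)/2 for all N;
TrialUpperBound2D at Q = P_a gives the matching limsup, hence E(N)/N → e(P_a); TrialUpperBound2D at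
arbitrary Q plus the lower bound gives
e(P_a) ≤ e(Q), i.e. IsLeast ⇒ HasPeriodicGroundStateEnergy lennardJones 2. Positional half: for any
sequence of ground states,
DefectCoresCostEnergy2D and StrainCostsEnergy2D give #{¬Hex η} ≤ (2E(N) − N f(a))(1 + C/c₀)/c(η) =
o(N) by the energetic half, which is the
antecedent of Exactification2D ⇒ IsCrystallizing lennardJones 2. (SharpEnergyBound2D is also the c =
0 case of rank 2; HexagonRigidity2D is
consumed inside Exactification2D, not by the assembly term.)

Rationale: WHY THIS LINE. The card proposed a POINTWISE one-centre inequality Φ(x)+T(x) ≤ Φ_tri(a*) with a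
calibrated finite-range transfer, then exactification and
hexagon rigidity. Working it through (planner's own analysis, NOTES.md) shows the pointwise form
with any FINITE-range configuration-covariant
transfer and the FULL r⁻⁶ tail is false: far-field density changes act at first order on sites whose
R-neighbourhood is perfect (the tail
exerts pressure: V′(r) > 0 beyond r = 1, and f′(a*) = 0 only balances near and far field under
UNIFORM dilation), while a covariant
finite-range transfer delivers zero net inflow to such sites (constant-field obstruction); globally
these first-order terms cancel pairwise
(reciprocity), so the correct load-bearing statements are TRANSFER-FREE, GLOBAL coercive bounds
"energy excess over N·e* controls the number
of non-hexagonal particles" — filed here as the cruxes — and the one-centre certificate survives as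
the layer-2 ENGINE for the near field
measured at each site's OWN local scale (zero-pressure bookkeeping), glued to a tail-domination
lemma (Two-layer plan). Everything downstream
is soft and rests on PROVED cone facts (BlancLewin2015_8_holds: Fekete limit e_∞ = inf E(N)/N for d
≤ 5; exists_isGroundState_lennardJones;
siteEnergy_nonpos_of_isGroundState; PeriodicConfiguration.summable_lennardJones_dist;
tendsto_sum_of_eventually_near′; Theil2006.triPoint /
latticeSum). Imported areas: certified computation (interval branch-and-bound for the near-field
certificate, as in Betermin2023 for the
lattice-only problem and Flyspeck-type local inequalities), discrete rigidity
(FrieseckeJamesMuller2002-type estimates enter StrainCostsEnergy2D),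
calibrations/null-Lagrangians (the transfer). What it does that prior routes do not: all three open
routes are d = 3 and fight stacking /
kissing degeneracy; this one isolates the tail/well-width difficulty where geometry is rigid (the
hexagon is the unique kissing configuration)
and states it sharply. Sources: BlancLewin2015 §2.1–2.3, Theil2006, ELi2008, LucaFriesecke2016,
AuYeungFrieseckeSchmidt2012, Betermin2023
(arXiv:2104.09795), BeterminPetrache2019 (arXiv:1806.02233), HeitmannRadin1980,
FrieseckeJamesMuller2002.

RANKED CRUXES. #0 PlanarCrystallization (target) — Blanc–Lewin crystallization for true (12,6)
Lennard-Jones in the plane: E(N)/N converges to the attained minimum of the energy per particle over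
periodic configurations of ℝ², and ground states converge locally, along subsequences and up to
translations, to a non-zero lattice-periodic point measure (here: a rotated a*·A₂). (why it might
fail: Open since Radin 1981 / Theil 2006 for the true (12,6) tail; fails iff some non-triangular
(multi-lattice or aperiodic) arrangement ties or beats a*·A₂ for (12,6) in d=2 — excluded only among
Bravais lattices (Betermin2023).) [BlancLewin2015, Theil2006, Betermin2023, arXiv:1806.02233,
LucaFriesecke2016]
#2 DefectCoresCostEnergy2D (crux) — MASTER GAP INEQUALITY. Let a > 0 minimise Theil's dilated
triangular lattice sum f(b) = Σ_{ξ∈A₂∖0} V_LJ(b|ξ|) over b > 0 (a = a* = 0.99019, f(a*) = 2e* =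
−0.563687). There is c > 0 such that for every N and every configuration x of N points of ℝ² with
pairwise distances ≥ 1/2: N·f(a) + c·#{i : particle i is NOT (1/8)-hexagonal at scale a} ≤ 2·E(x),
where "i is η-hexagonal" means: some affine isometry g with g 0 = x_i has a particle within ηa of
g(a·u) for each of the six units u of A₂ and every particle within 3a/2 of x_i lies within ηa of
g(a·{0, units}). Boundary particles count as defects (and pay: surface energy). With c = 0 this is
SharpEnergyBound2D. Intended proof (layer 2): near-field one-centre certificate at each site's own
local scale with a covariant finite-range antisymmetric transfer (interval arithmetic over ≤
~40-point environments of radius ≈ 2.5, separation 1/2) + tail domination. [difficulty: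
open-problem] (why it might fail: False iff a non-hexagonal local motif is asymptotically free for
true (12,6) in d=2 (5–7 pairs, Z=7 flowers priced ~0 once the r⁻⁶ tail is counted: bare one-centre
count already gives 7/12=0.583>0.5637) or a non-triangular periodic state ties a*·A₂; c must also
absorb boundary sites.) [BlancLewin2015, Theil2006, LucaFriesecke2016, HeitmannRadin1980,
Betermin2023, AuYeungFrieseckeSchmidt2012]
#3 StrainCostsEnergy2D (crux) — HARMONIC/ELASTIC REGIME. With a as above there is C such that for
every η > 0 there is c(η) > 0 with, for every (1/2)-separated N-point configuration x of ℝ²: N·f(a)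
+ c(η)·#{i not η-hexagonal at scale a} ≤ 2·E(x) + C·#{i not (1/8)-hexagonal at scale a}. I.e. after
charging a flat C per strongly defective particle (paid by DefectCoresCostEnergy2D), mildly strained
particles cost energy quadratically (expected c(η) ≍ κη², κ from the elastic moduli of a*·A₂
INCLUDING the tail). This is where long-wavelength density modulations, the tail's first-order
pressure and discrete rigidity (Friesecke–James–Müller / Theil's V_*) live; glue with rank 2: #{¬Hex
η} ≤ (2E − N f(a))(1 + C/c₀)/c(η). [deps: DefectCoresCostEnergy2D] [difficulty: XL] (why it might
fail: Needs Born/phonon stability of a*·A₂ WITH the r⁻⁶ tail plus a sharp global control of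
far-field first-order (pressure) terms against quadratic near-field strain cost — finite-range
localisation provably fails here; also uniqueness of the optimal scale is implicitly asserted.)
[FrieseckeJamesMuller2002, Theil2006, ELi2008, AuYeungFrieseckeSchmidt2012, BlancLewin2015,
arXiv:1601.05968]
#4 SharpEnergyBound2D (crux) — SHARP FINITE-N LOWER BOUND (energetic planar crystallization): with a
as above, N·f(a) ≤ 2·E(x) for every (1/2)-separated N-point configuration x of ℝ² — no finite
cluster beats the triangular crystal's energy per particle e* = f(a*)/2 = −0.281844. Equivalent
(Fekete: BlancLewin2015_8_holds gives e_∞ = inf_N E(N)/N; SeparationHalf2D) to lim E(N)/N =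
e(a*·A₂); the c = 0 shadow of rank 2, filed as the independently closable milestone: with the
supports it alone yields HasPeriodicGroundStateEnergy lennardJones 2. Intended proof: non-coercive
one-centre certificate + tail domination. [difficulty: open-problem] (why it might fail: It IS the
energetic 2-D conjecture for true (12,6): false iff a periodic non-Bravais or aperiodic arrangement
has lower LJ energy per particle than a*·A₂ (proved impossible only among Bravais lattices,
Betermin2023; BeterminFurlanetto2026 numerics agree).) [Betermin2023, BeterminFurlanetto2026,
BlancLewin2015, Theil2006, arXiv:1806.02233]
#9 SeparationHalf2D (support) — every Lennard-Jones ground state in ℝ² has all interparticle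
distances ≥ 1/2 (removal inequality siteEnergy ≤ 0 + 2-D packing count; the in-tree 3-D proof
LennardJonesMinimalDistance_holds adapts and gives ≈ 0.52; KiesslingWales2025 survey 3-D constants).
[difficulty: provable-now] [Xue1997, Blanc2004, KiesslingWales2025, BlancLewin2015]
#9 TrialUpperBound2D (support) — for every periodic configuration Q of ℝ² and ε > 0, eventually
E(N)/N ≤ e(Q) + ε (parallelogram blocks of Q as trial states along N_L = #F·L², cut bonds cost o(N)
by summability of the r⁻⁶ tail in d = 2; pass to all N with the Fekete limit
BlancLewin2015_8_holds). [difficulty: provable-now] [BlancLewin2015, Theil2006]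
#9 OptimalScale2D (support) — the dilated triangular lattice sum of V_LJ attains its minimum over b
> 0 at some a ∈ [19/20, 1] (homogeneity: f(b) = S₁₂ b⁻¹²/12 − S₆ b⁻⁶/6 with S_n = Σ_{ξ∈A₂∖0}|ξ|⁻ⁿ,
S₆ = 6.37588, S₁₂ = 6.00981, a⁶ = S₁₂/S₆; needs only 6 ≤ S₁₂ ≤ S₆ ≤ 8.1). [difficulty: provable-now]
[Theil2006, BlancLewin2015]
#9 TriangularConfiguration2D (support) — for a > 0 the scaled triangular lattice a·A₂ (motif {0},
lattice ℤ a b₁ + ℤ a b₂) is a PeriodicConfiguration 2 whose point set is the range of k ↦ a·triPoint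
k and whose LJ energy per particle is f(a)/2 (Blanc–Lewin (23)). [difficulty: provable-now]
[BlancLewin2015, Theil2006]
#9 HexagonRigidity2D (support) — HEXAGONS PROPAGATE IN THE PLANE: a non-empty set S ⊂ ℝ² in which
every point p sees, within open radius 3a/2, exactly a rigid image g_p(a·{0, six units}) with g_p 0
= p, is a rigid image of a·A₂ (one shared vertex fixes the neighbouring hexagon; connectedness of
A₂; covering radius a/√3 < 3a/2). The d = 2 substitute for Fejes Tóth–Hales, with no stacking
freedom. [difficulty: provable-now] [HeitmannRadin1980, LucaFriesecke2016]
#9 Exactification2D (support) — ZERO DEFECT DENSITY ⇒ BLANC–LEWIN CONVERGENCE: if for some a > 0 and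
every η > 0 the fraction of non-η-hexagonal particles in LJ ground states tends to 0, then
IsCrystallizing lennardJones 2 (choose centres with defect-free R_j-windows, η_j → 0; local
compactness of 1/2-separated configurations; the exact limit has exact hexagons ⇒ HexagonRigidity2D
⇒ rotated translate of a·A₂ = isometryImage/translate of TriangularConfiguration2D; conclude with
PeriodicConfiguration.tendsto_sum_of_eventually_near′, m ≡ 1 by SeparationHalf2D). [difficulty: M]
[BlancLewin2015, LucaFriesecke2016]

TWO-LAYER PLAN. Foreseen split of DefectCoresCostEnergy2D (k = 2, after design work; NOT filed now):
NearFieldOwnScale2D → TailDomination2D → DefectCoresCostEnergy2D.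
NearFieldOwnScale2D (the card's engine, made correct) = ∃ finite-range, bounded,
translation-covariant, antisymmetric pair transfer t such that
for every 1/2-separated X and x ∈ X: E_x^{≤R₀}(X) + Σ_y t(x,y;X) ≥ F_{R₀}(s_X(x)) + c·1[x not
(1/8)-hexagonal], where E_x^{≤R₀} is the site
energy truncated at R₀ ≈ 5/2–3, s_X(x) a covariant clamped local scale (mean first-shell distance)
and F_{R₀}(b) the truncated lattice sum at
scale b — reference at the site's OWN scale, so every perfect lattice of any scale is an exact
equality case and the near-field pressure term
cancels (a reference "min_b F_{R₀}" would leave a garbage Δ_F > 0 per site at the true lattice,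
since argmin F_{R₀} ≠ a*). Certified by interval
branch-and-bound over environments of ≤ ~40 points (separation 1/2, radius ≈ 2.5) after analytic
pre-cleaning of crammed pairs (V(0.7) = +4.60).
TailDomination2D (transfer-free, since Σ_x t = 0): ∃ κ ∈ (0,1): 2(E(X) − |X| e*) ≥ κ·(2E^{≤R₀}(X) −
Σ_x F_{R₀}(s_X(x))) — the far tail claws
back at most a fraction 1−κ of the near-field excess; first-order far-field terms cancel pairwise
(reciprocity), second-order far terms are
≍ Σ_{|ξ|>R₀}|ξ|²|V″| ≈ 0.7 % of the near-field stiffness. StrainCostsEnergy2D's foreseen children: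
PhononStability2D (certified positivity of the
a*·A₂ dynamical matrix with tail, Brillouin-zone interval arithmetic) → LocalRigidityToStrainCount2D
(F-J-M on defect-free patches) → StrainCostsEnergy2D.

KILL CRITERIA. A finite 1/2-separated planar cluster, or a periodic configuration, with LJ energy
per particle < e* = −0.281844 refutes SharpEnergyBound2D,
hence ranks 2–3 and the planar conjecture itself: close `refuted:SharpEnergyBound2D` (the witness is
a theorem worth a Literature file). A
family of configurations with #{non-(1/8)-hexagonal} ≍ N but 2E − N f(a*) = o(N) refutes rank 2 only
(cheap defect motifs): pivot to a
weaker defect functional (larger radius / motif-aware) by `--restate`. Basin-hopping showing the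
near-field own-scale certificate fails for
every bounded finite-range transfer kills the ENGINE, not the cruxes: pivot layer 2 to F-J-M
rigidity + certified elastic constants. A proof
of the planar statement elsewhere (any method) moots the route; nothing here is mooted by progress
on d = 3.

NOT DECOMPOSED YET. The near/far split radius R₀, the local-scale functional s_X, the transfer class
and the cramming pre-cleaning (layer-2 design, see Two-layer
plan); the value of c₀ (expected 10⁻²–10⁻¹) and of κ in c(η) ≍ κη²; certified elastic moduli /
phonon spectrum of a*·A₂ with tail; the
exact bootstrap constant in SeparationHalf2D (1/2 is what the assembly uses; 0.7–0.8 is reachable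
and would shrink the certificate); whether
(1/8, 3a/2) in the hexagonality predicate are the most convenient thresholds (any fixed pair works
for the assembly).

CHEAPEST FALSIFIER. (1) kit basin-hopping over 1/2-separated planar clusters N ≤ 60 and over
small-motif periodic configurations (#F ≤ 4, relaxed cell):
is min (2E − N f(a*))/#{non-(1/8)-hexagonal} bounded away from 0, and is e(Q) ≥ e* with equality
only at a*·A₂? Known 2-D LJ cluster minima
are hexagonal patches, so a violation would be news. (2) For the engine: maximise the bare truncated
one-centre functional over ≤ 25-point
environments (separation 1/2): the planner's hand count already shows Z = 7 at radius 1 beats Φ_tri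
(7/12 = 0.5833 > 0.5637) while each
adjacent shell pair pays only V(0.868) = +0.066 — so the transfer is NECESSARY; the test is whether
neighbour slack (≈ 0.3 per shell atom)
covers the ≈ 0.02–0.08 deficit with a bounded covariant rule. Not run here (hub is compute-free;
minutes of kit time for a refuter).

NUMBERS. A₂ sums (NN distance 1): S₆ = 6.375882, S₁₂ = 6.009814; a* = (S₁₂/S₆)^{1/6} = 0.990194; 2e*
= f(a*) = −S₆²/(12 S₁₂) = −0.563687, e* = −0.281844
(vs 6·V(1) = −0.5: the tail is 11 %); f(1) = −0.561829. V(0.5) = +330.7, V(0.7) = +4.604, V(0.75) =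
+1.694, V(0.868) = +0.0659, V(1) = −1/12,
V(√3) = −0.00606, V(2) = −0.00258. V″(a*) = 7.35, V″(√3a*) = −0.087, V″(2a*) = −0.029: tail
stiffness ≈ −0.7 vs NN +44. Lattice tail per site
beyond 2.2: 0.0106; beyond 3: 0.00295; beyond 4: 0.00111; max-density (separation 0.7) tail ≈ 2.2×
lattice tail — why crude pointwise tail
bounds lose sharpness. Crude 2-D removal+packing separation: 0.523 (> 1/2). Best rigorous 3-D
separation 0.684 r₀ (KiesslingWales2025: 0.767764σ).
Theil-class exclusion of (12,6): Theil2006.not_isAdmissible_lennardJones (in tree). Items at open: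
11 (3 cruxes, 1 target, 6 support, 1 assembly).

DEFINITION REQUESTS. None at open: all statements elaborate over Crystallization.lean +
Theil2006.lean (triPoint, latticeSum) + Mathlib (AffineIsometryEquiv).
A named predicate `IsLocallyHexagonal η a x i`
(Summits/AtomisticToContinuum/Crystallization/Theorems) would shorten four statements; to be
requested by the tenure planner if provers ask — the inline form is the source of truth now.

Novelty: Searches (2026-08-15): `lit search --hybrid "two-dimensional Lennard-Jones crystallization
triangular lattice ground state proof"` (12 rows:
arXiv:2107.14020 lattice-only, Alicandro–Braides–Cicalese book; rest noise); `lit frontier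
AtomisticToContinuum --since 2020` (30 rows; relevant:
arXiv:2407.20762 BeterminFurlanetto2026 — HR sticky disc with arbitrary norm + LJ lattice numerics;
arXiv:2604.19239 Kreutz–Ziereis 2026 —
Γ-limit to polycrystals for frame-indifferent RIGID local energies, not LJ); `lit search --source
zbmath` for "crystallization two dimensions
pair potential" (Theil2006, AuYeungFrieseckeSchmidt2012, LucaFriesecke2016), "E Li crystallization
hexagonal lattice" (ELi2008), "minimal
distance Lennard-Jones cluster" (Schachinger et al. 2007, KiesslingWales2025 arXiv:2511.15008),
"Betermin Lennard-Jones triangular"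
(Betermin2023 arXiv:2104.09795, arXiv:1611.07820, arXiv:1806.02233, Kui–Zou 2025
doi:10.1063/5.0269445 exponential-decay potentials);
`lit galaxy search "crystallization in two dimensions" --star all` (19 rows: Kubin–Ponsiglione
arXiv:2004.06820 hard spheres + Riesz tail,
Alicandro–Lazzaroni–Palombaro arXiv:1601.05968 rigidity beyond NN; rest noise); `lit bridges
AtomisticToContinuum --cross any` (nothing planar);
OpenAlex/S2 rate-limited today (logged). Negatives index: empty.
Nearest prior art found: Theil2006 / ELi2008 (d = 2 energy + positional results for narrow-well,
tiny-tail classes; (12,6) excluded by the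
in-tree theorem Theil2006.not_isAdmissib  [refs: 10.1063/5.0269445, 2107.14020, 2407.20762, 2604.19239, 2511.15008, 2104.09795, 1611.07820, 1806.02233, 2004.06820, 1601.05968, doi:10.1063/5.0269445, BeterminFurlanetto2026, Theil2006, AuYeungFrieseckeSchmidt2012, LucaFriesecke2016, ELi2008, KiesslingWales2025, Betermin2023, HeitmannRadin1980, Schmidt2013]

Barriers (technique_class: defect-count coercivity, one-centre certificate, rigidity): - technique_class: defect-count coercivity, one-centre certificate, rigidity
- Literature.Barriers.AtomisticToContinuum.LocalizedPotentialsExcludeLennardJones: APPLIES and is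
the wall this route must beat (in tree: Theil2006.not_isAdmissible_lennardJones,
FlatleyTheil2015.not_isLocalizedPair_lennardJones). Evaded by construction: no smallness parameter
anywhere — the cruxes carry the full r⁻⁶ tail with the sharp constant f(a*), and the engine treats
the tail by zero-pressure own-scale bookkeeping + tail domination instead of |V″| ≤ αr⁻⁷. The bet:
c₀ > 0 survives the tail (numbers above: tail stiffness 1.6 % of NN).
- Literature.Barriers.AtomisticToContinuum.KissingTwelveDegeneracy: does not apply — d = 2, the
hexagon is the unique kissing-six configuration and HexagonRigidity2D has no stacking freedom (this
absence is the card's raison d'être).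
- Literature.Barriers.AtomisticToContinuum.FlexibleKissingArrangements: does not apply in d = 2 (six
unit discs around one are rigid); the η-hexagonal predicate is coercive by StrainCostsEnergy2D, not
by shell combinatorics.
- Literature.Barriers.AtomisticToContinuum.TetrahedralFrustration: absent in d = 2 (equilateral
triangles tile the plane); not used, not evaded.
- Literature.Barriers.AtomisticToContinuum.IcosahedralClusters: d = 3 phenomenon (LJ₁₃); planar
small clusters are hexagonal patches; SharpEnergyBound2D is stated for all N and is consistent with
them (surface terms are positive).
- Literature.Barriers.AtomisticToContinuum

History (route lifecycle, newest last):
- 2026-08-15T13:45:38Z · CLOSED retired — not-a-thesis: assembly does not conclude the sub-problem Statement (operator:999:1257524)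

sub-problem: Crystallization · status: closed(retired) · opened planner-plancard-AtomisticToContinuum-Crystal-a8695a89-0 2026-08-15T11:32:34Z · rev 0 · ledger route-AtomisticToContinuum-PlaneFirstTrueLJ
GENERATED by the gate from the ledger (D-0016/17). Provers cite these decls: `theorem foo : Summit.AtomisticToContinuum.Crystallization.Theses.PlaneFirstTrueLJ.<Decl> := …` in Summits/AtomisticToContinuum/Crystallization/Theorems/<Name>.lean.
-/

namespace Summit.AtomisticToContinuum.Crystallization.Theses.PlaneFirstTrueLJ

open scoped BigOperators Topology Manifold Classical MeasureTheory ProbabilityTheory Matrix InnerProductSpace ComplexConjugate ContinuousMap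
open Filter Set Function TopologicalSpace MeasureTheory

attribute [summit_statement] _root_.Crystallization

/-- item stmt-AtomisticToContinuum-4318 · target · rank 0 · closed · moot by None · by planner
why it might fail: Open since Radin 1981 / Theil 2006 for the true (12,6) tail; fails iff some non-triangular (multi-lattice or aperiodic) arrangement ties or beats a*·A₂ for (12,6) in d=2 — excluded only among Bravais lattices (Betermin2023).
sources: BlancLewin2015, Theil2006, Betermin2023, arXiv:1806.02233, LucaFriesecke2016
[target] Blanc–Lewin crystallization for true (12,6) Lennard-Jones in the plane: E(N)/N converges to
the attained minimum of the energy per particle over periodic configurations of ℝ², and ground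
states converge locally, along subsequences and up to translations, to a non-zero lattice-periodic
point measure (here: a rotated a*·A₂). -/
@[route_item "route-AtomisticToContinuum-PlaneFirstTrueLJ"]
def PlanarCrystallization : Prop :=
  Literature.MathematicalPhysics.StatisticalMechanics.HasPeriodicGroundStateEnergy Literature.MathematicalPhysics.StatisticalMechanics.lennardJones 2 ∧ Literature.MathematicalPhysics.StatisticalMechanics.IsCrystallizing Literature.MathematicalPhysics.StatisticalMechanics.lennardJones 2

/-- item stmt-AtomisticToContinuum-4319 · crux · rank 2 · closed · moot by None · by planner
why it might fail: False iff a non-hexagonal local motif is asymptotically free for true (12,6) in d=2 (5–7 pairs, Z=7 flowers priced ~0 once the r⁻⁶ tail is counted: bare one-centre count already gives 7/12=0.583>0.5637) or a non-triangular periodic state ties a*·A₂; c must also absorb boundary sites.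
sources: BlancLewin2015, Theil2006, LucaFriesecke2016, HeitmannRadin1980, Betermin2023, AuYeungFrieseckeSchmidt2012
[crux] MASTER GAP INEQUALITY. Let a > 0 minimise Theil's dilated triangular lattice sum f(b) =
Σ_{ξ∈A₂∖0} V_LJ(b|ξ|) over b > 0 (a = a* = 0.99019, f(a*) = 2e* = −0.563687). There is c > 0 such
that for every N and every configuration x of N points of ℝ² with pairwise distances ≥ 1/2: N·f(a) +
c·#{i : particle i is NOT (1/8)-hexagonal at scale a} ≤ 2·E(x), where "i is η-hexagonal" means: some
affine isometry g with g 0 = x_i has a particle within ηa of g(a·u) for each of the six units u of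
A₂ and every particle within 3a/2 of x_i lies within ηa of g(a·{0, units}). Boundary particles count
as defects (and pay: surface energy). With c = 0 this is SharpEnergyBound2D. Intended proof (layer
2): near-field one-centre certificate at each site's own local scale with a covariant finite-range
antisymmetric transfer (interval arithmetic over ≤ ~40-point environments of radius ≈ 2.5,
separation 1/2) + tail domination. [difficulty: open-problem] -/
@[route_item "route-AtomisticToContinuum-PlaneFirstTrueLJ"]
def DefectCoresCostEnergy2D : Prop :=
  let T : ℤ × ℤ → EuclideanSpace ℝ (Fin 2) := fun k => !₂[(k.1 : ℝ) + (k.2 : ℝ) / 2, Real.sqrt 3 / 2 * (k.2 : ℝ)]; let f : ℝ → ℝ := fun b => ∑' k : {k : ℤ × ℤ // k ≠ 0}, Literature.MathematicalPhysics.StatisticalMechanics.lennardJones (b * ‖T k.1‖); let Hex : ℝ → ℝ → (N : ℕ) → (Fin N → EuclideanSpace ℝ (Fin 2)) → Fin N → Prop := fun η a N x i => ∃ g : EuclideanSpace ℝ (Fin 2) ≃ᵃⁱ[ℝ] EuclideanSpace ℝ (Fin 2), g 0 = x i ∧ (∀ k : ℤ × ℤ, k ≠ 0 → k.1 ^ 2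 + k.1 * k.2 + k.2 ^ 2 ≤ 1 → ∃ j : Fin N, dist (x j) (g (a • T k)) ≤ η * a) ∧ (∀ j : Fin N, dist (x j) (x i) ≤ 3 / 2 * a → ∃ k : ℤ × ℤ, k.1 ^ 2 + k.1 * k.2 + k.2 ^ 2 ≤ 1 ∧ dist (x j) (g (a • T k)) ≤ η * a); ∀ a : ℝ, 0 < a → (∀ b : ℝ, 0 < b → f a ≤ f b) → ∃ c : ℝ, 0 < c ∧ ∀ (N : ℕ) (x : Fin N → EuclideanSpace ℝ (Fin 2)), (∀ i j, i ≠ j → (1 : ℝ) / 2 ≤ dist (x i) (x j)) → (N : ℝ) * f a + c * ((Finset.univ.filter fun i : Fin N => ¬ Hex (1 / 8) a N x i).card : ℝ) ≤ 2 * Literature.MathematicalPhysics.StatisticalMechanics.interactionEnergy Literature.MathematicalPhysics.StatisticalMechanics.lennardJones x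

/-- item stmt-AtomisticToContinuum-4320 · crux · rank 3 · closed · moot by None · by planner
why it might fail: Needs Born/phonon stability of a*·A₂ WITH the r⁻⁶ tail plus a sharp global control of far-field first-order (pressure) terms against quadratic near-field strain cost — finite-range localisation provably fails here; also uniqueness of the optimal scale is implicitly asserted.
sources: FrieseckeJamesMuller2002, Theil2006, ELi2008, AuYeungFrieseckeSchmidt2012, BlancLewin2015, arXiv:1601.05968
[crux] HARMONIC/ELASTIC REGIME. With a as above there is C such that for every η > 0 there is c(η) >
0 with, for every (1/2)-separated N-point configuration x of ℝ²: N·f(a) + c(η)·#{i not η-hexagonal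
at scale a} ≤ 2·E(x) + C·#{i not (1/8)-hexagonal at scale a}. I.e. after charging a flat C per
strongly defective particle (paid by DefectCoresCostEnergy2D), mildly strained particles cost energy
quadratically (expected c(η) ≍ κη², κ from the elastic moduli of a*·A₂ INCLUDING the tail). This is
where long-wavelength density modulations, the tail's first-order pressure and discrete rigidity
(Friesecke–James–Müller / Theil's V_*) live; glue with rank 2: #{¬Hex η} ≤ (2E − N f(a))(1 +
C/c₀)/c(η). [deps: DefectCoresCostEnergy2D] [difficulty: XL] -/
@[route_item "route-AtomisticToContinuum-PlaneFirstTrueLJ"]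
def StrainCostsEnergy2D : Prop :=
  let T : ℤ × ℤ → EuclideanSpace ℝ (Fin 2) := fun k => !₂[(k.1 : ℝ) + (k.2 : ℝ) / 2, Real.sqrt 3 / 2 * (k.2 : ℝ)]; let f : ℝ → ℝ := fun b => ∑' k : {k : ℤ × ℤ // k ≠ 0}, Literature.MathematicalPhysics.StatisticalMechanics.lennardJones (b * ‖T k.1‖); let Hex : ℝ → ℝ → (N : ℕ) → (Fin N → EuclideanSpace ℝ (Fin 2)) → Fin N → Prop := fun η a N x i => ∃ g : EuclideanSpace ℝ (Fin 2) ≃ᵃⁱ[ℝ] EuclideanSpace ℝ (Fin 2), g 0 = x i ∧ (∀ k : ℤ × ℤ, k ≠ 0 → k.1 ^ 2 + k.1 * k.2 + k.2 ^ 2 ≤ 1 → ∃ j : Fin N, dist (x j) (g (a • T k)) ≤ η * a) ∧ (∀ j : Fin N, dist (x j) (x i) ≤ 3 / 2 * a → ∃ k : ℤ × ℤ, k.1 ^ 2 + k.1 * k.2 + k.2 ^ 2 ≤ 1 ∧ dist (x j) (g (a • T k)) ≤ η * a); ∀ a : ℝ, 0 < a → (∀ b : ℝ, 0 < b → f a ≤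 f b) → ∃ C : ℝ, ∀ η : ℝ, 0 < η → ∃ c : ℝ, 0 < c ∧ ∀ (N : ℕ) (x : Fin N → EuclideanSpace ℝ (Fin 2)), (∀ i j, i ≠ j → (1 : ℝ) / 2 ≤ dist (x i) (x j)) → (N : ℝ) * f a + c * ((Finset.univ.filter fun i : Fin N => ¬ Hex η a N x i).card : ℝ) ≤ 2 * Literature.MathematicalPhysics.StatisticalMechanics.interactionEnergy Literature.MathematicalPhysics.StatisticalMechanics.lennardJones x + C * ((Finset.univ.filter fun i : Fin N => ¬ Hex (1 / 8) a N x i).card : ℝ)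

/-- item stmt-AtomisticToContinuum-4321 · crux · rank 4 · closed · moot by None · by planner
why it might fail: It IS the energetic 2-D conjecture for true (12,6): false iff a periodic non-Bravais or aperiodic arrangement has lower LJ energy per particle than a*·A₂ (proved impossible only among Bravais lattices, Betermin2023; BeterminFurlanetto2026 numerics agree).
sources: Betermin2023, BeterminFurlanetto2026, BlancLewin2015, Theil2006, arXiv:1806.02233
[crux] SHARP FINITE-N LOWER BOUND (energetic planar crystallization): with a as above, N·f(a) ≤
2·E(x) for every (1/2)-separated N-point configuration x of ℝ² — no finite cluster beats the
triangular crystal's energy per particle e* = f(a*)/2 = −0.281844. Equivalent (Fekete: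
BlancLewin2015_8_holds gives e_∞ = inf_N E(N)/N; SeparationHalf2D) to lim E(N)/N = e(a*·A₂); the c =
0 shadow of rank 2, filed as the independently closable milestone: with the supports it alone yields
HasPeriodicGroundStateEnergy lennardJones 2. Intended proof: non-coercive one-centre certificate +
tail domination. [difficulty: open-problem] -/
@[route_item "route-AtomisticToContinuum-PlaneFirstTrueLJ"]
def SharpEnergyBound2D : Prop :=
  let T : ℤ × ℤ → EuclideanSpace ℝ (Fin 2) := fun k => !₂[(k.1 : ℝ) + (k.2 : ℝ) / 2, Real.sqrt 3 / 2 * (k.2 : ℝ)]; let f : ℝ → ℝ := fun b => ∑' k : {k : ℤ × ℤ // k ≠ 0}, Literature.MathematicalPhysics.StatisticalMechanics.lennardJones (b * ‖T k.1‖); ∀ a : ℝ, 0 < a → (∀ b : ℝ, 0 < b → f a ≤ f b) → ∀ (N : ℕ) (x : Fin N → EuclideanSpace ℝ (Fin 2)), (∀ i j, i ≠ j → (1 : ℝ) / 2 ≤ dist (x i) (x j)) → (N : ℝ) * f a ≤ 2 * Literature.MathematicalPhysics.StatisticalMechanics.interactionEnergy Literature.MathematicalPhysics.StatisticalMechanics.lennardJones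 x

/-- item stmt-AtomisticToContinuum-4322 · support · rank 9 · closed · moot by None · by planner
sources: Xue1997, Blanc2004, KiesslingWales2025, BlancLewin2015
[support] every Lennard-Jones ground state in ℝ² has all interparticle distances ≥ 1/2 (removal
inequality siteEnergy ≤ 0 + 2-D packing count; the in-tree 3-D proof
LennardJonesMinimalDistance_holds adapts and gives ≈ 0.52; KiesslingWales2025 survey 3-D constants).
[difficulty: provable-now] -/
@[route_item "route-AtomisticToContinuum-PlaneFirstTrueLJ"]
def SeparationHalf2D : Prop :=
  ∀ (N : ℕ) (x : Fin N → EuclideanSpace ℝ (Fin 2)), Literature.MathematicalPhysics.StatisticalMechanics.IsGroundState Literature.MathematicalPhysics.StatisticalMechanics.lennardJones x → ∀ i j : Fin N, i ≠ j → (1 : ℝ) / 2 ≤ dist (x i) (x j)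

/-- item stmt-AtomisticToContinuum-4323 · support · rank 9 · closed · moot by None · by planner
sources: BlancLewin2015, Theil2006
[support] for every periodic configuration Q of ℝ² and ε > 0, eventually E(N)/N ≤ e(Q) + ε
(parallelogram blocks of Q as trial states along N_L = #F·L², cut bonds cost o(N) by summability of
the r⁻⁶ tail in d = 2; pass to all N with the Fekete limit BlancLewin2015_8_holds). [difficulty:
provable-now] -/
@[route_item "route-AtomisticToContinuum-PlaneFirstTrueLJ"]
def TrialUpperBound2D : Prop :=
  ∀ (Q : Literature.MathematicalPhysics.StatisticalMechanics.PeriodicConfiguration 2) (ε : ℝ), 0 < ε → ∀ᶠ N : ℕ in Filter.atTop, Literature.MathematicalPhysics.StatisticalMechanics.groundStateEnergy Literature.MathematicalPhysics.StatisticalMechanics.lennardJones 2 N / (N : ℝ) ≤ Q.energyPerParticle Literature.MathematicalPhysics.StatisticalMechanics.lennardJones + ε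

/-- item stmt-AtomisticToContinuum-4324 · support · rank 9 · closed · moot by None · by planner
sources: Theil2006, BlancLewin2015
[support] the dilated triangular lattice sum of V_LJ attains its minimum over b > 0 at some a ∈
[19/20, 1] (homogeneity: f(b) = S₁₂ b⁻¹²/12 − S₆ b⁻⁶/6 with S_n = Σ_{ξ∈A₂∖0}|ξ|⁻ⁿ, S₆ = 6.37588, S₁₂
= 6.00981, a⁶ = S₁₂/S₆; needs only 6 ≤ S₁₂ ≤ S₆ ≤ 8.1). [difficulty: provable-now] -/
@[route_item "route-AtomisticToContinuum-PlaneFirstTrueLJ"]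
def OptimalScale2D : Prop :=
  let T : ℤ × ℤ → EuclideanSpace ℝ (Fin 2) := fun k => !₂[(k.1 : ℝ) + (k.2 : ℝ) / 2, Real.sqrt 3 / 2 * (k.2 : ℝ)]; let f : ℝ → ℝ := fun b => ∑' k : {k : ℤ × ℤ // k ≠ 0}, Literature.MathematicalPhysics.StatisticalMechanics.lennardJones (b * ‖T k.1‖); ∃ a : ℝ, 19 / 20 ≤ a ∧ a ≤ 1 ∧ ∀ b : ℝ, 0 < b → f a ≤ f b

/-- item stmt-AtomisticToContinuum-4325 · support · rank 9 · closed · moot by None · by planner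
sources: BlancLewin2015, Theil2006
[support] for a > 0 the scaled triangular lattice a·A₂ (motif {0}, lattice ℤ a b₁ + ℤ a b₂) is a
PeriodicConfiguration 2 whose point set is the range of k ↦ a·triPoint k and whose LJ energy per
particle is f(a)/2 (Blanc–Lewin (23)). [difficulty: provable-now] -/
@[route_item "route-AtomisticToContinuum-PlaneFirstTrueLJ"]
def TriangularConfiguration2D : Prop :=
  let T : ℤ × ℤ → EuclideanSpace ℝ (Fin 2) := fun k => !₂[(k.1 : ℝ) + (k.2 : ℝ) / 2, Real.sqrt 3 / 2 * (k.2 : ℝ)]; let f : ℝ → ℝ := fun b => ∑' k : {k : ℤ × ℤ // k ≠ 0}, Literature.MathematicalPhysics.StatisticalMechanics.lennardJones (b * ‖T k.1‖); ∀ a : ℝ, 0 < a → ∃ P : Literature.MathematicalPhysics.StatisticalMechanics.PeriodicConfiguration 2, P.points = Set.range (fun k : ℤ × ℤ => a • T k) ∧ P.energyPerParticle Literature.MathematicalPhysics.StatisticalMechanics.lennardJones = f a / 2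

/-- item stmt-AtomisticToContinuum-4326 · support · rank 9 · closed · moot by None · by planner
sources: HeitmannRadin1980, LucaFriesecke2016
[support] HEXAGONS PROPAGATE IN THE PLANE: a non-empty set S ⊂ ℝ² in which every point p sees,
within open radius 3a/2, exactly a rigid image g_p(a·{0, six units}) with g_p 0 = p, is a rigid
image of a·A₂ (one shared vertex fixes the neighbouring hexagon; connectedness of A₂; covering
radius a/√3 < 3a/2). The d = 2 substitute for Fejes Tóth–Hales, with no stacking freedom.
[difficulty: provable-now] -/
@[route_item "route-AtomisticToContinuum-PlaneFirstTrueLJ"]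
def HexagonRigidity2D : Prop :=
  let T : ℤ × ℤ → EuclideanSpace ℝ (Fin 2) := fun k => !₂[(k.1 : ℝ) + (k.2 : ℝ) / 2, Real.sqrt 3 / 2 * (k.2 : ℝ)]; ∀ (a : ℝ) (S : Set (EuclideanSpace ℝ (Fin 2))), 0 < a → S.Nonempty → (∀ p ∈ S, ∃ g : EuclideanSpace ℝ (Fin 2) ≃ᵃⁱ[ℝ] EuclideanSpace ℝ (Fin 2), g 0 = p ∧ ∀ q : EuclideanSpace ℝ (Fin 2), dist q p < 3 / 2 * a → (q ∈ S ↔ ∃ k : ℤ × ℤ, k.1 ^ 2 + k.1 * k.2 + k.2 ^ 2 ≤ 1 ∧ q = g (a • T k))) → ∃ g : EuclideanSpace ℝ (Fin 2) ≃ᵃⁱ[ℝ] EuclideanSpace ℝ (Fin 2), S = Set.range (fun k : ℤ × ℤ => g (a • T k))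

/-- item stmt-AtomisticToContinuum-4327 · support · rank 9 · closed · moot by None · by planner
sources: BlancLewin2015, LucaFriesecke2016
[support] ZERO DEFECT DENSITY ⇒ BLANC–LEWIN CONVERGENCE: if for some a > 0 and every η > 0 the
fraction of non-η-hexagonal particles in LJ ground states tends to 0, then IsCrystallizing
lennardJones 2 (choose centres with defect-free R_j-windows, η_j → 0; local compactness of
1/2-separated configurations; the exact limit has exact hexagons ⇒ HexagonRigidity2D ⇒ rotated
translate of a·A₂ = isometryImage/translate of TriangularConfiguration2D; conclude with
PeriodicConfiguration.tendsto_sum_of_eventually_near′, m ≡ 1 by SeparationHalf2D). [difficulty: M] -/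
@[route_item "route-AtomisticToContinuum-PlaneFirstTrueLJ"]
def Exactification2D : Prop :=
  let T : ℤ × ℤ → EuclideanSpace ℝ (Fin 2) := fun k => !₂[(k.1 : ℝ) + (k.2 : ℝ) / 2, Real.sqrt 3 / 2 * (k.2 : ℝ)]; let Hex : ℝ → ℝ → (N : ℕ) → (Fin N → EuclideanSpace ℝ (Fin 2)) → Fin N → Prop := fun η a N x i => ∃ g : EuclideanSpace ℝ (Fin 2) ≃ᵃⁱ[ℝ] EuclideanSpace ℝ (Fin 2), g 0 = x i ∧ (∀ k : ℤ × ℤ, k ≠ 0 → k.1 ^ 2 + k.1 * k.2 + k.2 ^ 2 ≤ 1 → ∃ j : Fin N, dist (x j) (g (a • T k)) ≤ η * a) ∧ (∀ j : Fin N, dist (x j) (x i) ≤ 3 / 2 * a → ∃ k : ℤ × ℤ, k.1 ^ 2 + k.1 * k.2 + k.2 ^ 2 ≤ 1 ∧ dist (x j) (g (a • T k)) ≤ η * a); (∀ (N : ℕ) (x : Fin N → EuclideanSpace ℝ (Fin 2)), Literature.MathematicalPhysics.StatisticalMechanics.IsGroundState Literature.MathematicalPhysics.StatisticalMechanics.lennardJones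 x → ∀ i j : Fin N, i ≠ j → (1 : ℝ) / 2 ≤ dist (x i) (x j)) → (∃ a : ℝ, 0 < a ∧ ∀ η : ℝ, 0 < η → ∀ x : (N : ℕ) → (Fin N → EuclideanSpace ℝ (Fin 2)), (∀ N, Literature.MathematicalPhysics.StatisticalMechanics.IsGroundState Literature.MathematicalPhysics.StatisticalMechanics.lennardJones (x N)) → Filter.Tendsto (fun N : ℕ => ((Finset.univ.filter fun i : Fin N => ¬ Hex η a N (x N) i).card : ℝ) / (N : ℝ)) Filter.atTop (nhds 0)) → Literature.MathematicalPhysics.StatisticalMechanics.IsCrystallizing Literature.MathematicalPhysics.StatisticalMechanics.lennardJones 2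

/-- item stmt-AtomisticToContinuum-4328 · assembly · rank 1 · closed · moot by None · by planner
sources: BlancLewin2015
[assembly] DefectCoresCostEnergy2D → StrainCostsEnergy2D → SharpEnergyBound2D → SeparationHalf2D →
TrialUpperBound2D → OptimalScale2D → TriangularConfiguration2D → Exactification2D →
PlanarCrystallization. -/
@[route_item "route-AtomisticToContinuum-PlaneFirstTrueLJ"]
def Assembly : Prop :=
  DefectCoresCostEnergy2D → StrainCostsEnergy2D → SharpEnergyBound2D → SeparationHalf2D → TrialUpperBound2D → OptimalScale2D → TriangularConfiguration2D → Exactification2D → PlanarCrystallization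

end Summit.AtomisticToContinuum.Crystallization.Theses.PlaneFirstTrueLJ
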